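import Literature.NumberTheory.EllipticCurves.HeckeTraceHyperbolicPart
import Literature.NumberTheory.QuadraticFields.BinaryQuadraticFormsPZDomain
import Literature.NumberTheory.Automorphic.HeckeTraceFormulaGL2Level
import HarnessLib

/-!
# The elliptic part of `tr(T̃_n | ℚ[Γ₀(N)\SL₂(ℤ)])` (squarefree level)

Evaluation of the `E`-bracket of the Popa–Zagier element against the fixed-point count
`Fix_N(M)` for squarefree `N` prime to `n`:

  `∑_{det M = n} w_E(M) Fix_N(M)
     = 12 ∑_{t² < 4n} (∏_{ℓ ∣ N} r_ℓ(t, n)) ∑_{f} (∏_{ℓ ∣ N, ℓ ∣ f} (ℓ + 1)) h_w((t² − 4n)/f²)`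

(`finsum_bw_wE_fixCount`), `f` over the conductors of `HeckeTraceFormulaGL2Level.ellipticConductors`.
An elliptic `M = (a b; c d)` of trace `t` corresponds to the positive definite form
`Q_M = (c, d − a, −b)` of discriminant `t² − 4n` (`formOf`, `matOf`); `w_E(M)` is the Popa–Zagier
weight `pzWeight Q_M`, `Fix_N(M) = ∏_ℓ r_ℓ(t, n) · ∏_{ℓ ∣ N, ℓ ∣ cont(Q_M)} (ℓ + 1)`
(`fixCount_eq_prod`), and writing `Q = g Q'` with `Q'` primitive of discriminant `(t² − 4n)/g²`
the sum of the weights over `Q'` is `12 h_w` (`BinQF.sum_pzWeight_rat`).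

## References
* [Popa2014] A. Popa, Res. Math. Sci. 5 (2018), §2.3 (elliptic classes).
* [PopaZagier2017] A. Popa, D. Zagier, arXiv:1711.00327, §4 (12).
* [SchoofVandervlugt1991] R. Schoof, M. van der Vlugt, J. Combin. Theory A 57 (1991), Thm. 2.2.
-/

noncomputable section

open scoped MatrixGroups
open Matrix Literature.NumberTheory.Automorphic.PopaZagier
open Literature.NumberTheory.QuadraticFields.Quadratic
open Literature.NumberTheory.Automorphic.HeckeTraceFormulaGL2Level (ellipticConductors weightedClassNumber)

namespace Literature.NumberTheory.EllipticCurves.ModularForms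

/-! ### Elliptic matrices and forms -/

/-- The form `Q_M = (c, d − a, −b)` of `M = (a b; c d)`. [cite: Popa2014, §2.3] -/
def formOf (M : Matrix (Fin 2) (Fin 2) ℤ) : BinQF := ⟨M 1 0, M 1 1 - M 0 0, -M 0 1⟩

/-- The matrix of trace `t` attached to the form `Q = (A, B, C)`: `((t − B)/2, −C; A, (t + B)/2)`.
[cite: Popa2014, §2.3] -/
def matOf (t : ℤ) (Q : BinQF) : Matrix (Fin 2) (Fin 2) ℤ := !![(t - Q.b) / 2, -Q.c; Q.a, (t + Q.b) / 2]

/-- `disc Q_M = (tr M)² − 4 det M`. [folklore] -/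
theorem disc_formOf (M : Matrix (Fin 2) (Fin 2) ℤ) : (formOf M).disc = (M 0 0 + M 1 1) ^ 2 - 4 * M.det := by
  simp only [formOf, BinQF.disc, Matrix.det_fin_two]; ring

/-- `matOf (tr M) Q_M = M`. [folklore] -/
theorem matOf_formOf (M : Matrix (Fin 2) (Fin 2) ℤ) : matOf (M 0 0 + M 1 1) (formOf M) = M := by
  unfold matOf formOf
  ext i j; fin_cases i <;> fin_cases j <;> simp <;> omega

/-- For `disc Q ≡ t² (mod 4)` (automatic when `disc Q = t² − 4n`): `Q_{matOf t Q} = Q`. [folklore] -/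
theorem formOf_matOf {t : ℤ} {Q : BinQF} (h : ∃ m : ℤ, Q.disc = t ^ 2 - 4 * m) : formOf (matOf t Q) = Q := by
  obtain ⟨m, hm⟩ := h
  unfold BinQF.disc at hm
  have hpar : 2 ∣ t - Q.b := by
    have h2 : (2 : ℤ) ∣ (t - Q.b) * (t + Q.b) := ⟨-2 * Q.a * Q.c + 2 * m, by nlinarith⟩
    rcases (Int.prime_two.dvd_mul).mp h2 with h | h
    · exact h
    · have : t - Q.b = (t + Q.b) - 2 * Q.b := by ring
      rw [this]; exact dvd_sub h (dvd_mul_right 2 _)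
  obtain ⟨k, hk⟩ := hpar
  unfold formOf matOf
  ext <;> simp
  · have e1 : (t - Q.b) / 2 = k := by rw [hk]; simp
    have e2 : (t + Q.b) / 2 = k + Q.b := by
      rw [show t + Q.b = 2 * (k + Q.b) by linarith]; simp
    rw [e1, e2]; ring

/-- Trace of `matOf t Q`. [folklore] -/
theorem trace_matOf {t : ℤ} {Q : BinQF} (h : ∃ m : ℤ, Q.disc = t ^ 2 - 4 * m) :
    matOf t Q 0 0 + matOf t Q 1 1 = t := by
  obtain ⟨m, hm⟩ := h
  unfold BinQF.disc at hm
  have hpar : 2 ∣ t - Q.b := by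
    have h2 : (2 : ℤ) ∣ (t - Q.b) * (t + Q.b) := ⟨-2 * Q.a * Q.c + 2 * m, by nlinarith⟩
    rcases (Int.prime_two.dvd_mul).mp h2 with h | h
    · exact h
    · have : t - Q.b = (t + Q.b) - 2 * Q.b := by ring
      rw [this]; exact dvd_sub h (dvd_mul_right 2 _)
  obtain ⟨k, hk⟩ := hpar
  simp only [matOf, Matrix.of_apply, Matrix.cons_val', Matrix.cons_val_zero, Matrix.cons_val_one,
    Matrix.cons_val_fin_one]
  have e1 : (t - Q.b) / 2 = k := by rw [hk]; simp
  have e2 : (t + Q.b) / 2 = k + Q.b := by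
    rw [show t + Q.b = 2 * (k + Q.b) by linarith]; simp
  rw [e1, e2]; linarith

/-- Determinant of `matOf t Q` when `disc Q = t² − 4n`. [folklore] -/
theorem det_matOf {t n : ℤ} {Q : BinQF} (h : Q.disc = t ^ 2 - 4 * n) : (matOf t Q).det = n := by
  have h' := h
  unfold BinQF.disc at h
  have hpar : 2 ∣ t - Q.b := by
    have h2 : (2 : ℤ) ∣ (t - Q.b) * (t + Q.b) := ⟨-2 * Q.a * Q.c + 2 * n, by nlinarith⟩
    rcases (Int.prime_two.dvd_mul).mp h2 with h | h
    · exact h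
    · have : t - Q.b = (t + Q.b) - 2 * Q.b := by ring
      rw [this]; exact dvd_sub h (dvd_mul_right 2 _)
  obtain ⟨k, hk⟩ := hpar
  rw [matOf, Matrix.det_fin_two_of]
  have e1 : (t - Q.b) / 2 = k := by rw [hk]; simp
  have e2 : (t + Q.b) / 2 = k + Q.b := by
    rw [show t + Q.b = 2 * (k + Q.b) by linarith]; simp
  rw [e1, e2]
  have ht : t = 2 * k + Q.b := by linarith
  rw [ht] at h
  have h4 : 4 * (k * (k + Q.b) - -Q.c * Q.a - n) = 0 := by linear_combination (-1 : ℤ) * h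
  omega

/-- **`w_E(M)` is the Popa–Zagier weight of `Q_M`.** [cite: PopaZagier2017, §4 (12)] -/
theorem wE_eq_pzWeight (a b c d : ℤ) : wE a b c d = BinQF.pzWeight ⟨c, d - a, -b⟩ := by
  unfold wE BinQF.pzWeight
  simp only
  split_ifs <;> omega

/-- `bw wE n M = [det M = n] · pzWeight Q_M`. [folklore] -/
theorem bw_wE_eq (n : ℤ) (M : Matrix (Fin 2) (Fin 2) ℤ) :
    bw wE n M = if M.det = n then (BinQF.pzWeight (formOf M) : ℚ) else 0 := by
  unfold bw formOf; rw [wE_eq_pzWeight]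

/-- The scalar factor `∏_{ℓ ∣ N, ℓ ∣ cont Q} (ℓ + 1)` of the fixed-point count, on forms. [folklore] -/
def contFactor (N : ℕ) (Q : BinQF) : ℕ :=
  ∏ ℓ ∈ N.primeFactors, (if (ℓ : ℤ) ∣ Q.a ∧ (ℓ : ℤ) ∣ Q.b ∧ (ℓ : ℤ) ∣ Q.c then ℓ + 1 else 1)

/-- **`Fix_N(M) = ∏_ℓ r_ℓ(t, n) · contFactor N Q_M`** for `det M = n` prime to the squarefree `N`.
[cite: SchoofVandervlugt1991, Thm. 2.2; Popa2014, §2.3] -/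
theorem fixCount_eq_rootCount_mul_contFactor {N : ℕ} [NeZero N] (hN : Squarefree N)
    (M : Matrix (Fin 2) (Fin 2) ℤ) (hM : IsCoprime M.det (N : ℤ)) :
    fixCount N M = (∏ ℓ ∈ N.primeFactors, rootCount (ZMod ℓ) ((M 0 0 + M 1 1 : ℤ) : ZMod ℓ) ((M.det : ℤ) : ZMod ℓ)) *
      contFactor N (formOf M) := by
  rw [fixCount_eq_prod hN M hM, contFactor, ← Finset.prod_mul_distrib]
  refine Finset.prod_congr rfl fun ℓ _ => ?_
  unfold localFix formOf
  simp only
  congr 1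
  have e1 : ((ℓ : ℤ) ∣ M 1 1 - M 0 0) ↔ ((ℓ : ℤ) ∣ M 0 0 - M 1 1) := dvd_sub_comm
  have e2 : ((ℓ : ℤ) ∣ -M 0 1) ↔ ((ℓ : ℤ) ∣ M 0 1) := dvd_neg
  simp only [e1, e2]
  by_cases h1 : (ℓ : ℤ) ∣ M 1 0 <;> by_cases h2 : (ℓ : ℤ) ∣ M 0 1 <;>
    by_cases h3 : (ℓ : ℤ) ∣ M 0 0 - M 1 1 <;> simp [h1, h2, h3]

/-! ### Reindexing by trace and form -/

/-- The traces of elliptic matrices of determinant `n`: `t² < 4n` (indexed as in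
`HeckeTraceFormulaGL2Level.ellipticTerm`). [cite: SchoofVandervlugt1991, Thm. 2.2 (A₂)] -/
def tSet (n : ℕ) : Finset ℤ := (Finset.Icc (-(2 * n : ℤ)) (2 * n)).filter fun t : ℤ => t ^ 2 < 4 * (n : ℤ)

/-- All (not necessarily primitive) forms of discriminant `D` with nonzero Popa–Zagier weight.
[cite: PopaZagier2017, §4 (12)] -/
def allSet (D : ℤ) : Finset BinQF := (BinQF.pzBox D).filter fun Q => Q.disc = D ∧ BinQF.pzWeight Q ≠ 0

/-- Membership in `allSet`. [folklore] -/
theorem mem_allSet_iff {D : ℤ} {Q : BinQF} : Q ∈ allSet D ↔ Q.disc = D ∧ BinQF.pzWeight Q ≠ 0 := by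
  unfold allSet
  rw [Finset.mem_filter]
  constructor
  · exact fun h => h.2
  · intro h
    refine ⟨?_, h⟩
    obtain ⟨ha, haD, hbD, hb, hc, hcD⟩ := BinQF.bounds_of_pzWeight_ne_zero h.1 h.2
    unfold BinQF.pzBox
    simp only [Finset.mem_image, Finset.mem_product, Finset.mem_Icc, Prod.exists]
    exact ⟨Q.a, Q.b, Q.c, ⟨⟨⟨by omega, haD⟩, hbD, hb⟩, by omega, hcD⟩, rfl⟩

/-- Forms of nonzero weight are (positive) definite: `disc < 0`. [folklore] -/
theorem disc_neg_of_pzWeight_ne_zero {Q : BinQF} (h : BinQF.pzWeight Q ≠ 0) : Q.disc < 0 := by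
  obtain ⟨ha, hc, hb, hba, hbc⟩ := (BinQF.pzWeight_ne_zero_iff Q).mp h
  unfold BinQF.disc
  nlinarith

/-- The trace–form index set of elliptic matrices of determinant `n`. [folklore] -/
def tqSet (n : ℕ) : Finset (Σ _ : ℤ, BinQF) := (tSet n).sigma fun t => allSet (t ^ 2 - 4 * n)

/-- **Reindexing the `E`-bracket by trace and form**:
`∑_M w_E(M)[det M = n] F(M) = ∑_{t² < 4n} ∑_{Q : disc Q = t² − 4n} w(Q) F(matOf t Q)`. [folklore] -/
theorem finsum_bw_wE_eq_sum {n : ℕ} (hn : 0 < n) (F : Matrix (Fin 2) (Fin 2) ℤ → ℚ) :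
    ∑ᶠ M, bw wE n M * F M =
      ∑ t ∈ tSet n, ∑ Q ∈ allSet (t ^ 2 - 4 * n), (BinQF.pzWeight Q : ℚ) * F (matOf t Q) := by
  classical
  let φ : (Σ _ : ℤ, BinQF) → Matrix (Fin 2) (Fin 2) ℤ := fun x => matOf x.1 x.2
  -- support in the image
  have hsupp : Function.support (fun M => bw wE n M * F M) ⊆ ((tqSet n).image φ : Finset _) := by
    intro M hM
    rw [Function.mem_support] at hM
    have h1 : bw wE n M ≠ 0 := fun h => hM (by rw [h, zero_mul])
    rw [bw_wE_eq] at h1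
    have hdet : M.det = n := by by_contra h; exact h1 (by rw [if_neg h])
    rw [if_pos hdet] at h1
    have hw : BinQF.pzWeight (formOf M) ≠ 0 := by exact_mod_cast h1
    have hdisc : (formOf M).disc = (M 0 0 + M 1 1) ^ 2 - 4 * n := by rw [disc_formOf, hdet]
    have hneg := disc_neg_of_pzWeight_ne_zero hw
    rw [hdisc] at hneg
    rw [Finset.mem_coe, Finset.mem_image]
    refine ⟨⟨M 0 0 + M 1 1, formOf M⟩, ?_, matOf_formOf M⟩
    unfold tqSet
    rw [Finset.mem_sigma]
    refine ⟨?_, mem_allSet_iff.mpr ⟨hdisc, hw⟩⟩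
    unfold tSet
    rw [Finset.mem_filter, Finset.mem_Icc]
    have hn' : (1 : ℤ) ≤ n := by exact_mod_cast hn
    refine ⟨⟨?_, ?_⟩, by linarith⟩ <;> nlinarith
  -- injectivity on the index set
  have hinj : Set.InjOn φ (tqSet n : Finset _) := by
    rintro ⟨t, Q⟩ hx ⟨t', Q'⟩ hy h
    simp only [Finset.mem_coe, tqSet, Finset.mem_sigma, mem_allSet_iff] at hx hy
    have hQ : ∃ m : ℤ, Q.disc = t ^ 2 - 4 * m := ⟨n, hx.2.1⟩
    have hQ' : ∃ m : ℤ, Q'.disc = t' ^ 2 - 4 * m := ⟨n, hy.2.1⟩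
    have ht : t = t' := by rw [← trace_matOf hQ, ← trace_matOf hQ']; simp only [φ] at h; rw [h]
    subst ht
    have hq : Q = Q' := by rw [← formOf_matOf hQ, ← formOf_matOf hQ']; simp only [φ] at h; rw [h]
    subst hq
    rfl
  rw [finsum_eq_sum_of_support_subset _ hsupp, Finset.sum_image hinj]
  unfold tqSet
  rw [Finset.sum_sigma]
  refine Finset.sum_congr rfl fun t _ => Finset.sum_congr rfl fun Q hQ => ?_
  have hdisc := (mem_allSet_iff.mp hQ).1
  simp only [φ]
  rw [bw_wE_eq, if_pos (det_matOf hdisc), formOf_matOf ⟨n, hdisc⟩]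

/-! ### Content decomposition of forms -/

/-- The scalar multiple `g Q`. [folklore] -/
def smulForm (g : ℤ) (Q : BinQF) : BinQF := ⟨g * Q.a, g * Q.b, g * Q.c⟩

/-- The content `gcd(A, B, C)` of a form. [cite: Cox2013, §2.A] -/
def cont (Q : BinQF) : ℕ := Nat.gcd (Nat.gcd Q.a.natAbs Q.b.natAbs) Q.c.natAbs

/-- Primitivity is `cont = 1`. [cite: Cox2013, §2.A] -/
theorem isPrimitive_iff_cont (Q : BinQF) : Q.IsPrimitive ↔ cont Q = 1 := Iff.rfl

/-- `disc (g Q) = g² disc Q`. [folklore] -/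
theorem disc_smulForm (g : ℤ) (Q : BinQF) : (smulForm g Q).disc = g ^ 2 * Q.disc := by
  simp only [smulForm, BinQF.disc]; ring

/-- `cont (g Q) = g cont Q`. [folklore] -/
theorem cont_smulForm (g : ℕ) (Q : BinQF) : cont (smulForm g Q) = g * cont Q := by
  simp only [cont, smulForm, Int.natAbs_mul, Int.natAbs_natCast, Nat.gcd_mul_left]

/-- The content divides the coefficients. [folklore] -/
theorem cont_dvd (Q : BinQF) : (cont Q : ℤ) ∣ Q.a ∧ (cont Q : ℤ) ∣ Q.b ∧ (cont Q : ℤ) ∣ Q.c := by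
  refine ⟨Int.natCast_dvd.mpr ?_, Int.natCast_dvd.mpr ?_, Int.natCast_dvd.mpr ?_⟩
  · exact (Nat.gcd_dvd_left _ _).trans (Nat.gcd_dvd_left _ _)
  · exact (Nat.gcd_dvd_left _ _).trans (Nat.gcd_dvd_right _ _)
  · exact Nat.gcd_dvd_right _ _

/-- The content of a form with `A ≠ 0` is positive. [folklore] -/
theorem cont_pos {Q : BinQF} (h : Q.a ≠ 0) : 0 < cont Q :=
  Nat.gcd_pos_of_pos_left _ (Nat.gcd_pos_of_pos_left _ (Int.natAbs_pos.mpr h))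

/-- The primitive part `Q / cont Q`. [cite: Cox2013, §2.A] -/
def primPart (Q : BinQF) : BinQF := ⟨Q.a / cont Q, Q.b / cont Q, Q.c / cont Q⟩

/-- `Q = cont(Q) · primPart Q`. [folklore] -/
theorem smulForm_cont_primPart (Q : BinQF) : smulForm (cont Q) (primPart Q) = Q := by
  obtain ⟨ha, hb, hc⟩ := cont_dvd Q
  simp only [smulForm, primPart]
  ext <;> simp [Int.mul_ediv_cancel' ha, Int.mul_ediv_cancel' hb, Int.mul_ediv_cancel' hc]

/-- The primitive part is primitive (for `A ≠ 0`). [cite: Cox2013, §2.A] -/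
theorem isPrimitive_primPart {Q : BinQF} (h : Q.a ≠ 0) : (primPart Q).IsPrimitive := by
  obtain ⟨ha, hb, hc⟩ := cont_dvd Q
  have hg := cont_pos h
  rw [isPrimitive_iff_cont]
  unfold cont primPart
  simp only [Int.natAbs_ediv_of_dvd ha, Int.natAbs_ediv_of_dvd hb, Int.natAbs_ediv_of_dvd hc,
    Int.natAbs_natCast]
  rw [Nat.gcd_div (Int.natCast_dvd.mp ha) (Int.natCast_dvd.mp hb),
    Nat.gcd_div ((Nat.dvd_gcd (Int.natCast_dvd.mp ha) (Int.natCast_dvd.mp hb))) (Int.natCast_dvd.mp hc)]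
  exact Nat.div_self hg

/-- `primPart (g Q') = Q'` for primitive `Q'` and `g ≥ 1`. [folklore] -/
theorem primPart_smulForm {g : ℕ} (hg : 0 < g) {Q : BinQF} (hQ : Q.IsPrimitive) :
    primPart (smulForm g Q) = Q := by
  have hc : cont (smulForm g Q) = g := by rw [cont_smulForm, (isPrimitive_iff_cont Q).mp hQ, mul_one]
  unfold primPart
  rw [hc]
  have hg' : (g : ℤ) ≠ 0 := by exact_mod_cast hg.ne'
  simp only [smulForm]
  ext <;> simp [Int.mul_ediv_cancel_left _ hg']

/-- **The weight is scale invariant.** [cite: PopaZagier2017, §4 (12)] -/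
theorem pzWeight_smulForm {g : ℤ} (hg : 0 < g) (Q : BinQF) :
    BinQF.pzWeight (smulForm g Q) = BinQF.pzWeight Q := by
  have h1 : ∀ x : ℤ, 0 < g * x ↔ 0 < x := fun x => by
    constructor <;> intro h
    · by_contra h'; rw [not_lt] at h'; nlinarith
    · positivity
  have h2 : ∀ x : ℤ, g * x ≤ 0 ↔ x ≤ 0 := fun x => by
    constructor <;> intro h
    · by_contra h'; rw [not_le] at h'; nlinarith
    · nlinarith
  have h3 : ∀ x y : ℤ, -(g * x) ≤ g * y ↔ -x ≤ y := fun x y => by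
    constructor <;> intro h
    · by_contra h'; rw [not_le] at h'; nlinarith
    · nlinarith
  have h4 : ∀ x y : ℤ, -(g * x) = g * y ↔ -x = y := fun x y => by
    rw [neg_mul_eq_mul_neg, (mul_right_injective₀ hg.ne').eq_iff]
  have h5 : ∀ x : ℤ, g * x = 0 ↔ x = 0 := fun x => by
    rw [mul_eq_zero, or_iff_right hg.ne']
  unfold BinQF.pzWeight smulForm
  simp only [h1, h2, h3, h4, h5]

/-- **The scalar factor of `g Q'` for primitive `Q'`**: `∏_{ℓ ∣ N, ℓ ∣ g} (ℓ + 1)`. [folklore] -/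
theorem contFactor_smulForm (N : ℕ) {g : ℕ} {Q : BinQF} (hQ : Q.IsPrimitive) :
    contFactor N (smulForm g Q) = ∏ ℓ ∈ N.primeFactors, (if ℓ ∣ g then ℓ + 1 else 1) := by
  unfold contFactor
  refine Finset.prod_congr rfl fun ℓ hℓ => ?_
  have hp : ℓ.Prime := Nat.prime_of_mem_primeFactors hℓ
  have hp' : Prime (ℓ : ℤ) := Nat.prime_iff_prime_int.mp hp
  simp only [smulForm]
  have key : ((ℓ : ℤ) ∣ g * Q.a ∧ (ℓ : ℤ) ∣ g * Q.b ∧ (ℓ : ℤ) ∣ g * Q.c) ↔ ℓ ∣ g := by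
    constructor
    · rintro ⟨ha, hb, hc⟩
      by_contra hg
      have hg' : ¬ (ℓ : ℤ) ∣ (g : ℤ) := fun h => hg (Int.natCast_dvd_natCast.mp h)
      have ha' : ℓ ∣ Q.a.natAbs := Int.natCast_dvd.mp ((hp'.dvd_or_dvd ha).resolve_left hg')
      have hb' : ℓ ∣ Q.b.natAbs := Int.natCast_dvd.mp ((hp'.dvd_or_dvd hb).resolve_left hg')
      have hc' : ℓ ∣ Q.c.natAbs := Int.natCast_dvd.mp ((hp'.dvd_or_dvd hc).resolve_left hg')
      have : ℓ ∣ cont Q := Nat.dvd_gcd (Nat.dvd_gcd ha' hb') hc'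
      rw [(isPrimitive_iff_cont Q).mp hQ, Nat.dvd_one] at this
      exact hp.ne_one this
    · intro h
      have h' : (ℓ : ℤ) ∣ (g : ℤ) := Int.natCast_dvd_natCast.mpr h
      exact ⟨h'.mul_right _, h'.mul_right _, h'.mul_right _⟩
  simp only [key]

/-- The conductors `f` with `f² ∣ D`, `D/f² ≡ 0, 1 (mod 4)` (`= ellipticConductors t n` for
`D = t² − 4n`). [cite: SchoofVandervlugt1991, Thm. 2.2 (A₂)] -/
def condSet (D : ℤ) : Finset ℕ :=
  (D.natAbs.divisors).filter fun f =>
    (f : ℤ) ^ 2 ∣ D ∧ ((D / (f : ℤ) ^ 2) % 4 = 0 ∨ (D / (f : ℤ) ^ 2) % 4 = 1)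

/-- `ellipticConductors t n = condSet (t² − 4n)` for `t² < 4n`.
[cite: SchoofVandervlugt1991, Thm. 2.2 (A₂)] -/
theorem ellipticConductors_eq {t : ℤ} {n : ℕ} (h : t ^ 2 < 4 * (n : ℤ)) :
    ellipticConductors t n = condSet (t ^ 2 - 4 * n) := by
  unfold ellipticConductors condSet
  have e : (4 * (n : ℤ) - t ^ 2).toNat = (t ^ 2 - 4 * (n : ℤ)).natAbs := by
    apply Int.ofNat.inj
    simp only [Int.ofNat_eq_natCast]
    rw [Int.toNat_of_nonneg (by linarith), ← Int.natAbs_neg, Int.natAbs_of_nonneg (by linarith)]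
    ring
  rw [e]

/-- **Content decomposition**: `∑_{Q : disc D, w ≠ 0} w(Q) c_N(Q) = ∑_g (∏_{ℓ ∣ N, ℓ ∣ g}(ℓ + 1)) · 12 h_w(D/g²)`
(`Q = g Q'`, `Q'` primitive of discriminant `D/g²`, and `BinQF.sum_pzWeight_rat`).
[cite: Popa2014, §2.3; SchoofVandervlugt1991, Prop. 2.1] -/
theorem sum_allSet_pzWeight_contFactor (N : ℕ) {D : ℤ} (hD : D < 0) :
    ∑ Q ∈ allSet D, (BinQF.pzWeight Q : ℚ) * (contFactor N Q : ℚ) =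
      ∑ g ∈ condSet D, (∏ ℓ ∈ N.primeFactors, (if ℓ ∣ g then (ℓ + 1 : ℚ) else 1)) *
        (12 * weightedClassNumber (D / (g : ℤ) ^ 2)) := by
  -- facts about conductors
  have hcond : ∀ g ∈ condSet D, 0 < g ∧ ((g : ℤ) ^ 2 ∣ D) ∧ D / (g : ℤ) ^ 2 < 0 := by
    intro g hg
    simp only [condSet, Finset.mem_filter, Nat.mem_divisors] at hg
    obtain ⟨⟨hgd, -⟩, hsq, -⟩ := hg
    have hg0 : 0 < g := Nat.pos_of_ne_zero fun h => by
      subst h; simp at hgd; omega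
    refine ⟨hg0, hsq, Int.ediv_neg_of_neg_of_pos hD (by positivity)⟩
  -- rewrite the right-hand side as a sum over pairs `(g, Q')`
  have hrhs : ∀ g ∈ condSet D, (12 * weightedClassNumber (D / (g : ℤ) ^ 2) : ℚ) =
      ∑ Q' ∈ BinQF.pzSet (D / (g : ℤ) ^ 2), (BinQF.pzWeight Q' : ℚ) := by
    intro g hg
    rw [BinQF.sum_pzWeight_rat (hcond g hg).2.2, weightedClassNumber]
  have hR : (∑ g ∈ condSet D, (∏ ℓ ∈ N.primeFactors, (if ℓ ∣ g then (ℓ + 1 : ℚ) else 1)) *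
        (12 * weightedClassNumber (D / (g : ℤ) ^ 2))) =
      ∑ x ∈ (condSet D).sigma (fun g => BinQF.pzSet (D / (g : ℤ) ^ 2)),
        (∏ ℓ ∈ N.primeFactors, (if ℓ ∣ x.1 then (ℓ + 1 : ℚ) else 1)) * (BinQF.pzWeight x.2 : ℚ) := by
    rw [Finset.sum_sigma]
    exact Finset.sum_congr rfl fun g hg => by rw [hrhs g hg, Finset.mul_sum]
  rw [hR]
  symm
  refine Finset.sum_bij' (fun x _ => smulForm x.1 x.2) (fun Q _ => ⟨cont Q, primPart Q⟩)
    (fun x hx => ?_) (fun Q hQ => ?_) (fun x hx => ?_) (fun Q hQ => ?_) (fun x hx => ?_)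
  · -- `g Q' ∈ allSet D`
    obtain ⟨g, Q'⟩ := x
    rw [Finset.mem_sigma] at hx
    obtain ⟨hg, hQ'⟩ := hx
    obtain ⟨hg0, hsq, -⟩ := hcond g hg
    obtain ⟨hp, hw⟩ := BinQF.mem_pzSet_iff.mp hQ'
    refine mem_allSet_iff.mpr ⟨?_, ?_⟩
    · rw [disc_smulForm, hp.disc_eq, Int.mul_ediv_cancel' hsq]
    · rw [pzWeight_smulForm (by exact_mod_cast hg0)]; exact hw
  · -- `(cont Q, Q / cont Q)` is a pair
    obtain ⟨hdisc, hw⟩ := mem_allSet_iff.mp hQ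
    obtain ⟨ha, -, -, -, -⟩ := (BinQF.pzWeight_ne_zero_iff Q).mp hw
    have hg0 : 0 < cont Q := cont_pos ha.ne'
    have hdecomp := smulForm_cont_primPart Q
    have hdiscP : D = (cont Q : ℤ) ^ 2 * (primPart Q).disc := by
      rw [← hdisc, ← disc_smulForm, hdecomp]
    have hsq : ((cont Q : ℤ) ^ 2 ∣ D) := ⟨_, hdiscP⟩
    have hdiv : D / (cont Q : ℤ) ^ 2 = (primPart Q).disc := by
      rw [hdiscP, Int.mul_ediv_cancel_left _ (by positivity)]
    have hP : (primPart Q).IsPosPrim (D / (cont Q : ℤ) ^ 2) :=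
      ⟨hdiv.symm, Int.ediv_pos_of_pos_of_dvd ha (by positivity) (cont_dvd Q).1,
        isPrimitive_primPart ha.ne'⟩
    rw [Finset.mem_sigma]
    refine ⟨?_, BinQF.mem_pzSet_iff.mpr ⟨hP, ?_⟩⟩
    · simp only [condSet, Finset.mem_filter, Nat.mem_divisors]
      refine ⟨⟨Int.natCast_dvd.mp (dvd_trans ⟨(cont Q : ℤ), by ring⟩ hsq), ?_⟩, hsq, ?_⟩
      · rw [Ne, Int.natAbs_eq_zero]; exact hD.ne
      · rw [hdiv, ← hdiv]; exact hP.emod_four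
    · rw [← pzWeight_smulForm (g := (cont Q : ℤ)) (by exact_mod_cast hg0), hdecomp]; exact hw
  · -- left inverse
    obtain ⟨g, Q'⟩ := x
    rw [Finset.mem_sigma] at hx
    obtain ⟨hg, hQ'⟩ := hx
    obtain ⟨hg0, -, -⟩ := hcond g hg
    obtain ⟨hp, -⟩ := BinQF.mem_pzSet_iff.mp hQ'
    have h1 : cont (smulForm g Q') = g := by
      rw [cont_smulForm, (isPrimitive_iff_cont Q').mp hp.primitive, mul_one]
    have h2 : primPart (smulForm g Q') = Q' := primPart_smulForm hg0 hp.primitive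
    exact Sigma.ext h1 (heq_of_eq h2)
  · -- right inverse
    exact smulForm_cont_primPart Q
  · -- the summands agree
    obtain ⟨g, Q'⟩ := x
    rw [Finset.mem_sigma] at hx
    obtain ⟨hg, hQ'⟩ := hx
    obtain ⟨hg0, -, -⟩ := hcond g hg
    obtain ⟨hp, -⟩ := BinQF.mem_pzSet_iff.mp hQ'
    simp only
    rw [pzWeight_smulForm (by exact_mod_cast hg0), contFactor_smulForm N hp.primitive, mul_comm]
    push_cast
    rfl

/-- **The `E`-part of `tr(T̃_n | ℚ[X_N])`** for squarefree `N` prime to `n`: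
`∑_{det M = n} w_E(M) Fix_N(M) = 12 ∑_{t² < 4n} (∏_{ℓ ∣ N} r_ℓ(t, n)) ∑_f (∏_{ℓ ∣ N, ℓ ∣ f}(ℓ + 1)) h_w((t² − 4n)/f²)`.
[cite: Popa2014, §2.3; SchoofVandervlugt1991, Thm. 2.2 (A₂)] -/
theorem finsum_bw_wE_fixCount {N : ℕ} [NeZero N] (hN : Squarefree N) {n : ℕ} (hn : 0 < n)
    (hnN : n.Coprime N) :
    ∑ᶠ M, bw wE n M * (fixCount N M : ℚ) =
      12 * ∑ t ∈ tSet n, (∏ ℓ ∈ N.primeFactors, (rootCount (ZMod ℓ) (t : ZMod ℓ) (n : ZMod ℓ) : ℚ)) *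
        ∑ f ∈ ellipticConductors t n,
          (∏ ℓ ∈ N.primeFactors, (if ℓ ∣ f then (ℓ + 1 : ℚ) else 1)) *
            weightedClassNumber ((t ^ 2 - 4 * n) / (f : ℤ) ^ 2) := by
  rw [finsum_bw_wE_eq_sum hn, Finset.mul_sum]
  refine Finset.sum_congr rfl fun t ht => ?_
  have ht2 : t ^ 2 < 4 * (n : ℤ) := by
    simp only [tSet, Finset.mem_filter] at ht; exact ht.2
  have hD : t ^ 2 - 4 * (n : ℤ) < 0 := by linarith
  have hcop : IsCoprime (n : ℤ) (N : ℤ) := Nat.isCoprime_iff_coprime.mpr hnN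
  -- evaluate the fixed-point counts on the fibre over `t`
  have hfix : ∀ Q ∈ allSet (t ^ 2 - 4 * n), (fixCount N (matOf t Q) : ℚ) =
      (∏ ℓ ∈ N.primeFactors, (rootCount (ZMod ℓ) (t : ZMod ℓ) (n : ZMod ℓ) : ℚ)) * contFactor N Q := by
    intro Q hQ
    have hdisc := (mem_allSet_iff.mp hQ).1
    have hdet : (matOf t Q).det = n := det_matOf hdisc
    rw [fixCount_eq_rootCount_mul_contFactor hN (matOf t Q) (by rw [hdet]; exact hcop),
      trace_matOf ⟨n, hdisc⟩, hdet, formOf_matOf ⟨n, hdisc⟩]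
    push_cast
    rfl
  rw [Finset.sum_congr rfl fun Q hQ => by rw [hfix Q hQ]]
  simp_rw [← mul_assoc, mul_comm (BinQF.pzWeight _ : ℚ), mul_assoc, ← Finset.mul_sum]
  rw [sum_allSet_pzWeight_contFactor N hD, ellipticConductors_eq ht2, Finset.mul_sum, Finset.mul_sum,
    Finset.mul_sum]
  refine Finset.sum_congr rfl fun g _ => ?_
  ring

end Literature.NumberTheory.EllipticCurves.ModularForms

end
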